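import Summits.Ventures.CertifiedManyBodySolver.Certificates.S2Rm2uTierP.Blocks01
import Summits.Ventures.CertifiedManyBodySolver.Certificates.S2Rm2uTierP.Blocks02
import Summits.Ventures.CertifiedManyBodySolver.Certificates.S2Rm2uTierP.Blocks03
import Summits.Ventures.CertifiedManyBodySolver.Certificates.S2Rm2uTierP.Blocks04
import Summits.Ventures.CertifiedManyBodySolver.Certificates.S2Rm2uTierP.Blocks05
import Summits.Ventures.CertifiedManyBodySolver.Certificates.S2Rm2uTierP.Blocks06
import Summits.Ventures.CertifiedManyBodySolver.Certificates.S2Rm2uTierP.Blocks07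
import Summits.Ventures.CertifiedManyBodySolver.Certificates.S2Rm2uTierP.Blocks08
import Summits.Ventures.CertifiedManyBodySolver.Certificates.S2Rm2uTierP.Blocks09
import Summits.Ventures.CertifiedManyBodySolver.Certificates.S2Rm2uTierP.Blocks10

/-!
# tier-P instance (S2Rm2u-R13-W3) — Gram blocks: assembly of the row pieces (a block split across modules is re-joined with `++`; row order unchanged)

Generated by hubbard-algo-p2's untrusted exporter (emit_v0.py + emit_w3.py); every datum below is re-derived / re-checked by the kernel chain
(`stepEQA`, Rows/CorrWindowCertKernelChainQuotAdj.lean) or is inert. HONEST FRAMING (xx1): instance data / kernel replay of a CONTROL/CALIBRATION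
certificate (S2′-Rm2-u″ OVERHANG pinned spoke of the La214-E t′-pair {S2′ −357/740, hub′ −3/10}: t′ = −357/740, CORNER objective t′_X = −3/10, eom multipliers PINNED to the hub-Rm2-u′ certificate (EB by name), sdp-1 (R1) C-edition j326976, 4^40-dyadic two-level Gram factors); nothing here is a theorem about the Hubbard model; no summit statement. [cite: Han2020Bootstrap, §3]
-/

set_option linter.style.longLine false
set_option maxRecDepth 100000
set_option maxHeartbeats 0

namespace Summit.Ventures.CertifiedManyBodySolver
namespace CARPolyWindow.TierP.S2Rm2u
open Summit.Ventures.CertifiedQuantumChemistry Summit.Ventures.CertifiedQuantumChemistry.CARPoly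
open Literature.MathematicalPhysics.QuantumLattice Literature.MathematicalPhysics.QuantumLattice.HubbardWave0
open Literature.Probability.LatticeModels
open CARPolyWindow

/-- All 45 Gram blocks (nesting-merge), certificate order. [cite: Han2020Bootstrap, §3] -/
def blocks : List (List (List ℤ × Terms (Orb (Fin 729)))) := [RV0p1, RV1p1, RV2p1, RV3p1, RV4p1, RV5p1, RV6p1, RV7p1, RV8p1, RV9p1, RV10p1, RV11p1, RV12p1, RV13p1, RV14p1, RV15p1, RV16p1, RV17p1, RV18p1, RV19p1, RV20p1, RV21p1, RV22p1, RV23p1, RV24p1, RV25p1, RV26p1, RV27p1, RV28p1, RV29p1, RV30p1, RV31p1, RV32p1, RV33p1, RV34p1, RV35p1, RV36p1, RV37p1, RV38p1, RV39p1, RV40p1, RV41p1, RV42p1, RV43p1, RV44p1 ++ RV44p2 ++ RV44p3]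

end CARPolyWindow.TierP.S2Rm2u
end Summit.Ventures.CertifiedManyBodySolver
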